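import Summits.BirchSwinnertonDyer.Rank1Residual.GaloisImage.PropagatedConditionCard
import Summits.BirchSwinnertonDyer.Rank1Residual.GaloisImage.EPCTateFormula
import HarnessLib

/-!
# (Lp) WITHOUT the binder `hEP`: the orders in `X = H¹(ℚ_v, E(ℚ̄_v))` and the count
# `#𝓕_can(E[p])_v = #E(ℚ_v)[p] · #(𝓞_v/p)²` now that Tate's local Euler–Poincaré characteristic is a
# theorem (cell `b2b-bsdres`, team n1011; seat p04 GEN 9; consumer rule R5-75 (b)(i) for row T-Lp)

HONEST FRAMING (cell `b2b-bsdres`, run/shared/lean/b2b/bsd-rank1-residual/, verbatim in every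
file): the goal of the cell is to DELETE the COMBINATION-SHAPED residual classes of the
Birch–Swinnerton-Dyer formula for ALL analytic-rank `≤ 1` elliptic curves over `ℚ` — "full BSD
formula for every rank `≤ 1` curve in class `C`" assembled STRICTLY from published theorems — so
that the rank-`≤ 1` remainder becomes exactly the CONSTRUCTION-SHAPED classes, which are TYPED
(missing-input `Prop`s), NOT attempted. This is not "finishing BSD". Team n1011 (N10 / N11, the
additive block X4 ∧ `p = 3`): research route; no claim beyond the stated classes; nothing is
booked; no mark / label is changed by this file. Theorems only (no definition, no named fact, no
`sorry`).

## What

Row T-Lp (seat p04 gen 5: `PropagatedConditionCount`, `PropagatedConditionCard`) computed, for an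
elliptic curve `E/ℚ`, a prime `p` and ANY finite place `v` of `ℚ`, the orders
`#X[p^k] = #E(ℚ_v)[p^k] · #(𝓞_v/p^k)` in `X = H¹(ℚ_v, E(ℚ̄_v))`, the stabilisation of
`D_N = p^N • X[p^{N+1}]` at order `#(𝓞_v/p)`, and the located local gap (Lp)
`#𝓕_can(E[p])_v = #E(ℚ_v)[p] · #(𝓞_v/p)²` (so `= p² · #E(ℚ_p)[p]` at `v = p`, `𝓕̄_v = 𝒦_v` at
`v ∤ p`, and p13's binder `hLpIm` at `p = 3`) — all under the binder
`hEP : localEulerPoincareCharacteristic ℚ_v`, Tate's local Euler–Poincaré characteristic, then a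
NAMED FACT of the tree.  Row T-EPC (seat p04 GEN 7–8) made that fact a THEOREM:
`EPCTate.localEulerPoincareCharacteristic (F)` (p300886, Milne *ADT* I Thm. 2.8 for every
non-archimedean local field of characteristic `0`).  This file feeds the theorem into the binder
(n1011 lead R5-75 (b)(i): "hEP discharged by p300886", by the consumer's own hand, one theorem per
statement), in the sub-namespace `EP` with the names of the originals:

* `EP.localEulerPoincareCharacteristic_adicCompletion K v` : Tate's formula at the completion
  `K_v` of any number field at any finite place (the shape of every `hEP` binder in the cell), and
  the family form `EP.forall_localEulerPoincareCharacteristic_adicCompletion K`;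
* `EP.natCard_torsionBy_localGaloisModule_pow`, `EP.finite_torsionBy_localGaloisModule_pow`,
  `EP.exists_level_map_pow_smul_torsionBy_stable` (the counting half, `PropagatedConditionCount`);
* `EP.natCard_propagatedSelmerStructureOne_inr`, `EP.natCard_propagatedSelmerStructureOne_of_mem`,
  `EP.propagatedSelmerStructureOne_inr_eq_kummer_of_not_mem`,
  `EP.natCard_propagatedSelmerStructureOne_three` ((Lp) itself, `PropagatedConditionCard`).

Nothing else changes: no statement is weakened or strengthened beyond deleting `hEP`; the (Lp)
theorems remain TOOL theorems of the N11 hypothesis side and close no class.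

References: J. S. Milne, *Arithmetic Duality Theorems* (2006), I Thm. 2.8, Thm. 3.2, Lemma 3.3
[MilneADT2006]; R. Greenberg, LNM 1716 (1999) §2; K. Rubin, *Euler systems and Kolyvagin systems*,
PCMS 18 (2011) §3.1 [Rubin2011].
-/

noncomputable section

open scoped Classical NumberField ContRepresentation
open Field NumberField IsDedekindDomain Function
open WeierstrassCurve Literature.NumberTheory.EllipticCurves Literature.NumberTheory.GaloisRepresentations
  Literature.NumberTheory.GaloisRepresentations.DiscreteGaloisModule

namespace Summit.BirchSwinnertonDyer.Rank1Residual.GaloisImage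

namespace EP

/-! ### Tate's formula at the completions of a number field -/

/-- **Tate's local Euler–Poincaré characteristic at `K_v`**: for a number field `K` and a finite
place `v`, `localEulerPoincareCharacteristic (v.adicCompletion K)` HOLDS — the shape of every `hEP`
binder of the cell, discharged by `EPCTate.localEulerPoincareCharacteristic` (p300886; `K_v` has
characteristic `0` as a `K`-algebra over a field).
[cite: MilneADT2006, I §2 Thm 2.8 (p. 31)] -/
theorem localEulerPoincareCharacteristic_adicCompletion (K : Type) [Field K] [NumberField K]
    (v : HeightOneSpectrum (𝓞 K)) : localEulerPoincareCharacteristic (v.adicCompletion K) := by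
  haveI : CharZero (v.adicCompletion K) :=
    charZero_of_injective_algebraMap (algebraMap K (v.adicCompletion K)).injective
  exact EPCTate.localEulerPoincareCharacteristic _

/-- **Tate's local Euler–Poincaré characteristic at every finite place of a number field** (the
family form `∀ v, localEulerPoincareCharacteristic K_v` of the cell's `hEP` binders).
[cite: MilneADT2006, I §2 Thm 2.8 (p. 31)] -/
theorem forall_localEulerPoincareCharacteristic_adicCompletion (K : Type) [Field K] [NumberField K] :
    ∀ v : HeightOneSpectrum (𝓞 K), localEulerPoincareCharacteristic (v.adicCompletion K) :=
  fun v => EP.localEulerPoincareCharacteristic_adicCompletion K v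

variable (W : WeierstrassCurve ℚ) [W.IsElliptic] (p : ℕ) [hp : Fact p.Prime]
  (v : HeightOneSpectrum (𝓞 ℚ))

/-! ### The counting half of T-Lp, `hEP` discharged -/

/-- **`#X[p^k] = #E(ℚ_v)[p^k] · #(𝓞_v/p^k)`** for every `k`, `X = H¹(ℚ_v, E(ℚ̄_v))`, unconditionally:
`GaloisImage.natCard_torsionBy_localGaloisModule_pow` with `hEP` discharged by p300886.
[cite: MilneADT2006, Ch. I, Thm. 3.2 and Lemma 3.3] -/
theorem natCard_torsionBy_localGaloisModule_pow (k : ℕ) :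
    Nat.card (AddSubgroup.torsionBy
        (galoisCohomology (W.localGaloisModule (Place.Completion (Sum.inr v : Place ℚ))) 1)
        ((p ^ k : ℕ) : ℤ)) =
      Nat.card (nsmulAddMonoidHom (p ^ k) : (W.baseChange (v.adicCompletion ℚ)).toAffine.Point →+ _).ker *
        Nat.card (v.adicCompletionIntegers ℚ ⧸
          Ideal.span {((p ^ k : ℕ) : v.adicCompletionIntegers ℚ)}) :=
  GaloisImage.natCard_torsionBy_localGaloisModule_pow W p v
    (EP.localEulerPoincareCharacteristic_adicCompletion ℚ v) k

/-- **`X[p^k]` is finite**, unconditionally: `GaloisImage.finite_torsionBy_localGaloisModule_pow`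
with `hEP` discharged by p300886. [cite: MilneADT2006, Ch. I, Thm. 3.2 and Lemma 3.3] -/
theorem finite_torsionBy_localGaloisModule_pow (k : ℕ) :
    Finite (AddSubgroup.torsionBy
        (galoisCohomology (W.localGaloisModule (Place.Completion (Sum.inr v : Place ℚ))) 1)
        ((p ^ k : ℕ) : ℤ)) :=
  GaloisImage.finite_torsionBy_localGaloisModule_pow W p v
    (EP.localEulerPoincareCharacteristic_adicCompletion ℚ v) k

/-- **Stabilisation of `D_N = p^N • X[p^{N+1}]` at order `#(𝓞_v/p)`**, unconditionally:
`GaloisImage.exists_level_map_pow_smul_torsionBy_stable` with `hEP` discharged by p300886.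
[cite: MilneADT2006, Ch. I, Thm. 3.2 and Lemma 3.3] -/
theorem exists_level_map_pow_smul_torsionBy_stable :
    ∃ N₀ : ℕ,
      (∀ N, N₀ ≤ N →
        (AddSubgroup.torsionBy
          (galoisCohomology (W.localGaloisModule (Place.Completion (Sum.inr v : Place ℚ))) 1)
          ((p ^ (N + 1) : ℕ) : ℤ)).map (zsmulAddGroupHom ((p ^ N : ℕ) : ℤ)) =
        (AddSubgroup.torsionBy
          (galoisCohomology (W.localGaloisModule (Place.Completion (Sum.inr v : Place ℚ))) 1)
          ((p ^ (N₀ + 1) : ℕ) : ℤ)).map (zsmulAddGroupHom ((p ^ N₀ : ℕ) : ℤ))) ∧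
      (∀ N,
        (AddSubgroup.torsionBy
          (galoisCohomology (W.localGaloisModule (Place.Completion (Sum.inr v : Place ℚ))) 1)
          ((p ^ (N₀ + 1) : ℕ) : ℤ)).map (zsmulAddGroupHom ((p ^ N₀ : ℕ) : ℤ)) ≤
        (AddSubgroup.torsionBy
          (galoisCohomology (W.localGaloisModule (Place.Completion (Sum.inr v : Place ℚ))) 1)
          ((p ^ (N + 1) : ℕ) : ℤ)).map (zsmulAddGroupHom ((p ^ N : ℕ) : ℤ))) ∧
      Nat.card ((AddSubgroup.torsionBy
          (galoisCohomology (W.localGaloisModule (Place.Completion (Sum.inr v : Place ℚ))) 1)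
          ((p ^ (N₀ + 1) : ℕ) : ℤ)).map (zsmulAddGroupHom ((p ^ N₀ : ℕ) : ℤ))) =
        Nat.card (v.adicCompletionIntegers ℚ ⧸
          Ideal.span {((p : ℕ) : v.adicCompletionIntegers ℚ)}) :=
  GaloisImage.exists_level_map_pow_smul_torsionBy_stable W p v
    (EP.localEulerPoincareCharacteristic_adicCompletion ℚ v)

/-! ### (Lp), `hEP` discharged -/

/-- **(Lp) at every finite place, unconditionally: `#𝓕_can(E[p])_v = #E(ℚ_v)[p] · #(𝓞_v/p) · #(𝓞_v/p)`**
— `GaloisImage.natCard_propagatedSelmerStructureOne_inr_of_localEuler` with `hEP` discharged by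
p300886 (Greenberg LNM 1716 §2; Milne *ADT* I Thm. 2.8 / 3.2 / Lemma 3.3).
[cite: MilneADT2006, Ch. I, Thm. 3.2 and Lemma 3.3] -/
theorem natCard_propagatedSelmerStructureOne_inr :
    Nat.card (propagatedSelmerStructureOne W p (Sum.inr v)) =
      Nat.card (nsmulAddMonoidHom p : (W.baseChange (v.adicCompletion ℚ)).toAffine.Point →+ _).ker *
        Nat.card (v.adicCompletionIntegers ℚ ⧸ Ideal.span {((p : ℕ) : v.adicCompletionIntegers ℚ)}) *
        Nat.card (v.adicCompletionIntegers ℚ ⧸ Ideal.span {((p : ℕ) : v.adicCompletionIntegers ℚ)}) :=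
  GaloisImage.natCard_propagatedSelmerStructureOne_inr_of_localEuler W p v
    (EP.localEulerPoincareCharacteristic_adicCompletion ℚ v)

/-- **(Lp) at the place `v ∣ p`, unconditionally: `#𝓕_can(E[p])_{(p)} = p² · #E(ℚ_p)[p]`** —
`GaloisImage.natCard_propagatedSelmerStructureOne_of_mem` with `hEP` discharged by p300886.
[cite: MilneADT2006, Ch. I, Thm. 3.2 and Lemma 3.3] -/
theorem natCard_propagatedSelmerStructureOne_of_mem (hv : ((p : ℕ) : 𝓞 ℚ) ∈ v.asIdeal) :
    Nat.card (propagatedSelmerStructureOne W p (Sum.inr v)) =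
      p ^ 2 * Nat.card (nsmulAddMonoidHom p : (W.baseChange (v.adicCompletion ℚ)).toAffine.Point →+ _).ker :=
  GaloisImage.natCard_propagatedSelmerStructureOne_of_mem W p v
    (EP.localEulerPoincareCharacteristic_adicCompletion ℚ v) hv

/-- **(Lp) at `v ∤ p`, unconditionally: `𝓕_can(E[p])_v = 𝒦_v`** (n1011-p06's (Lℓ) equality) —
`GaloisImage.propagatedSelmerStructureOne_inr_eq_kummer_of_not_mem_of_localEuler` with `hEP`
discharged by p300886. [cite: MilneADT2006, Ch. I, Lemma 3.3] -/
theorem propagatedSelmerStructureOne_inr_eq_kummer_of_not_mem (hv : ((p : ℕ) : 𝓞 ℚ) ∉ v.asIdeal) :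
    propagatedSelmerStructureOne W p (Sum.inr v) = W.kummerSelmerStructure (p : ℤ) (Sum.inr v) :=
  GaloisImage.propagatedSelmerStructureOne_inr_eq_kummer_of_not_mem_of_localEuler W p v
    (EP.localEulerPoincareCharacteristic_adicCompletion ℚ v) hv

/-- **(Lp) for N11, unconditionally — p13's binder `hLpIm` is a THEOREM: `#𝓕_can(E[3])_{(3)} = 9 · #E(ℚ₃)[3]`**
for every elliptic curve `E/ℚ` at the place above `3` —
`GaloisImage.natCard_propagatedSelmerStructureOne_three` with `hEP` discharged by p300886.
[cite: MilneADT2006, Ch. I, Thm. 3.2 and Lemma 3.3] -/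
theorem natCard_propagatedSelmerStructureOne_three (W : WeierstrassCurve ℚ) [W.IsElliptic]
    (v : HeightOneSpectrum (𝓞 ℚ)) (hv : ((3 : ℕ) : 𝓞 ℚ) ∈ v.asIdeal) :
    Nat.card (propagatedSelmerStructureOne W 3 (Sum.inr v)) =
      9 * Nat.card (nsmulAddMonoidHom 3 : (W.baseChange (v.adicCompletion ℚ)).toAffine.Point →+ _).ker :=
  GaloisImage.natCard_propagatedSelmerStructureOne_three W v
    (EP.localEulerPoincareCharacteristic_adicCompletion ℚ v) hv

end EP

end Summit.BirchSwinnertonDyer.Rank1Residual.GaloisImage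

end
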